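import Summits.BirchSwinnertonDyer.Rank1Residual.P2.RankOneSpecAtTwo
import Summits.BirchSwinnertonDyer.Rank1Residual.P2.CornerFTwoPrintInterface
import Literature.NumberTheory.EllipticCurves.SecondDescentShaExponentProofs
import Literature.NumberTheory.EllipticCurves.TianYuanZhang2017.ScriptLOddOfRhoZero
import Literature.NumberTheory.EllipticCurves.TianYuanZhang2017.GenusDescentEnSide
import Literature.NumberTheory.EllipticCurves.TianYuanZhang2017.GenusFieldFamily
import Literature.NumberTheory.EllipticCurves.CongruentNumberCurveTamagawaProofs
import Literature.NumberTheory.EllipticCurves.CongruentNumberCurveTorsionProofs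
import HarnessLib

/-!
# Leaf CornerF @ `p = 2`, crux `RamifiedOffTYZOfFacts` (stmt-BirchSwinnertonDyer-20509) — THE LEVEL-TWO
# DOOR: Tian–Yuan–Zhang's (1.1) READ AT THE PRIME `2` for every rank-one `E_n`
# (`BSD(E_n,2) ⟺ 2·ord₂ 𝓛(n) = ord₂ #Ш(E_n)[2^∞]`), and the transfer of the planner card
# `heegner-redei-level-two` PROVED: `2 ∥ 𝓛(n) ∧ #Sel₂(E_n) = 2⁵ ∧ #Sel₄(E_n) = 2⁶ ⟹ BSD(E_n, 2)`
# (cell `bsd-print-cf2`, typer ty2 = the discharge interface; fact-free)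

HONEST FRAMING (cell `bsd-print-cf2`, route `PrintCf2`, crux 20509 = `𝔅_ram → WAllCornerFTwoRamifiedOffTYZProved`,
OPEN; this file closes NO class and moves no mark). The planner-g5 idea card `heegner-redei-level-two`
(HOME/bsd-print-cf2-plan/Ideas/, filed as evidence on 20509) proposes to lift Tian–Yuan–Zhang's genus-point
induction one `2`-adic digit: its research stub `C⁺ = LevelTwoScriptLExact` says that on the Cassels–Tate
"jump-one" part of category D of the congruent-number residual (`n ≡ 5, 6, 7 (mod 8)` square-free,
`#Sel₂(E_n) = 2^{2+3}`, `ord_{s=1} L(E_n, s) = 1`, `#Sel₄(E_n) = 2⁶`) the authors' integer `𝓛(n)` is EXACTLY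
divisible by `2`. The card's skeleton then reads `stub_levelTwoScriptL (C⁺) → stub_shaOfSelmerFour →
stub_tyzNormalisation → BSD₂`. The second arrow is the tree theorem
`Literature.NumberTheory.EllipticCurves.natCard_primaryComponent_sha_two_eq_four_of_selmerFour` (p599547); THIS
file proves the third arrow and the composition, i.e. everything of the line except `C⁺` itself:

* §1 **TYZ's normalisation (1.1) read at `2`, ALL LEVELS** (`bsdp_two_congruentNumberCurve_iff_of_isScriptL`): for
  square-free `n`, granted Gross–Zagier–Kolyvagin (`hGZK`, conjunct 1 of `𝔅_ram`), if `ord_{s=1} L(E_n,s) = 1` and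
  `𝓛(n)² = L²` (`IsScriptL n L`, `L ∈ ℤ`), then `rank E_n(ℚ) = 1`, `Ш(E_n)` is finite, `L ≠ 0`, and
  **`BSD(E_n, 2) ⟺ 2·ord₂ L = ord₂ #Ш(E_n)[2^∞]`**. Mechanism, all PROVED in the tree:
  `L′(E_n,1) = 2^{2k(n)−2−a(n)}·L²·Ω(E_n)·Reg(E_n)` (`leadingLCoeff_congruentNumberCurve_eq_of_isScriptL`, with
  `Ω(E_n) = Ω_{n,∞}` `realPeriodRat_congruentNumberCurve`), the rank-one spec
  `P2.bsdp_two_iff_of_LDerivOverOmegaReg` (`BSD(E,2) ⟺ ord₂ x = ord₂ #Ш + ord₂ ∏c_ℓ − 2 ord₂ #E(ℚ)_tor`),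
  `ord₂ ∏c_ℓ(E_n) = 2k(n) + 2 − a(n)` (`padicValNat_two_tamagawaProduct_congruentNumberCurve`), `#E_n(ℚ)_tor = 4`
  (`torsionOrder_congruentNumberCurve`), `ord₂ #Ш = ord₂ #Ш[2^∞]` (`padicValNat_card_addPrimaryComponent`). The
  tree's doors so far fix `Ш[2^∞] = 0` and `L` odd (`…_of_sha_two_eq_bot_of_torsionOrder_eq_four`, p1's genus
  classes); this is the same bookkeeping with both digits free.
* §2 **THE LEVEL-TWO DOOR** (`bsdp_two_congruentNumberCurve_of_levelTwo`): `hGZK`, `r_an(E_n) = 1`, `IsScriptL n L`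
  with `2 ∣ L ∧ 4 ∤ L`, `#Sel₂(E_n) = 2⁵`, `#Sel₄(E_n) = 2⁶` ⟹ rank `1`, `Ш(E_n)[2^∞] = Ш(E_n)[2]` of order `4`, and
  **`BSD(E_n, 2)`**; and on that class the door is EXACT (`bsdp_two_congruentNumberCurve_iff_two_dvd_not_four_dvd`):
  `BSD(E_n, 2) ⟺ (2 ∣ L ∧ 4 ∤ L)` — the card's analytic target `2 ∥ 𝓛(n)` is not merely sufficient but
  EQUIVALENT to BSD₂ on the jump-one part of D with `r_an = 1`. Model transport to every globally minimal
  `W ≅ E_n` (`…_of_smul`) by ty2 g1's fact-free `CornerFTwo.CongruentNumber.analyticRank_eq_one_and_bsdp_two_of_smul`.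
* §3 **THE CARD'S SKELETON COMPOSED** (`bsdp_two_congruentNumberCurve_of_levelTwoScriptLExact`): with `C⁺` taken as a
  HYPOTHESIS in the card's exact binder shape (`∀ n [IsElliptic] [IsGloballyMinimal], Squarefree n → n % 8 ∈ {5,6,7} →
  r_an = 1 → #Sel₂ = 2⁵ → #Sel₄ = 2⁶ → ∀ L, IsScriptL n L → 2 ∣ L ∧ ¬ 4 ∣ L`; NOT declared here — it is the
  planner's research stub, no `def … : Prop` is introduced) and the two bundle conjuncts TYZ Thm 1.2 AS PRINTED
  (`h12'`, integrality of `𝓛(n)`: `∃ L, IsScriptL n L`, via `W2.stub_S3` for `ρ(n)` and `GenusField`) and GZK: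
  every member of the jump-one class with `r_an = 1` satisfies `BSD(E_n, 2)`, on the named model and on every
  globally minimal `ℚ`-model.
* §4 (append) the same in W-ALL leaf currency: `W.analyticRank = 1` read on the model `W` and a membership
  witness `∃ n C, … ∧ C • E_n = W` (`bsdp_two_of_levelTwo_of_smul_of_analyticRank_eq_one`,
  `bsdp_two_of_levelTwoScriptLExact_of_smul_of_analyticRank_eq_one`).

Nothing is asserted: every theorem is conditional exactly on its displayed hypotheses; `C⁺` is research (the
card's cheapest falsifier passed 182/182, kit j283973/j296810); no Literature fact is introduced (D-0026);
imports Literature + P2 only (no route file, bsd-wall T9). Beyond print: NO for §1–§2 (bookkeeping on printed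
and proved inputs); §3 is beyond print exactly to the extent `C⁺` is (nothing in print on the rank-one side at
level 2 — card §Dead lines (3)). BSD is not proved by any of this.

References: [TianYuanZhang2017] Tian–Yuan–Zhang, Asian J. Math. 21 (2017), §1 (1.1) and Thm 1.2 (arXiv:1411.4728
p0002); [Miller2011LMS] R. L. Miller, LMS J. Comput. Math. 14 (2011), Def. 1.1 (`BSD(E,p)`); [SilvermanAEC2009]
Thm X.4.2 (descent count); [HeathBrown1994SelmerCongruentII] §1 (`#Sel₂(E_n) = 2^{2+s(n)}`); [Darmon2004] Thm 3.22
(GZK, the binder `hGZK`). Card: HOME/bsd-print-cf2-plan/Ideas/idea-heegner-redei-level-two.md (crux 20509 evidence).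
-/

noncomputable section

open scoped Classical

open WeierstrassCurve Literature.NumberTheory.EllipticCurves
  Literature.NumberTheory.EllipticCurves.Rank1Residual
  Literature.NumberTheory.EllipticCurves.TianYuanZhang2017

set_option autoImplicit false

namespace Summit.BirchSwinnertonDyer.Rank1Residual.P2

/-! ## §1 TYZ's (1.1) read at the prime `2`, all levels -/

/-- The `2`-adic bookkeeping of the bridge: `2k(n) − 2 − a(n) = ord₂ ∏c_ℓ(E_n) − 4` (`∏c_ℓ = 2^{2k+2−a}`,
`padicValNat_two_tamagawaProduct_congruentNumberCurve`). (Same statement as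
`Rank1Residual.WAll.PrintCf2.twoExponent_eq_padicValNat_tamagawaProduct_sub_four`, re-proved here to keep the
`P2 → WAll` import direction.) [cite: TianYuanZhang2017, §1 (p0002 L51–L75)] -/
private theorem twoExponent_eq_padicValNat_tamagawaProduct_sub_four' {n : ℕ}
    [(congruentNumberCurve n).IsElliptic] (hsq : Squarefree n) :
    twoExponent n = (padicValNat 2 (congruentNumberCurve n).tamagawaProduct : ℤ) - 4 := by
  rw [padicValNat_two_tamagawaProduct_congruentNumberCurve hsq, twoExponent, oddPrimeFactorCount,
    oddIndicator]
  split_ifs <;> push_cast <;> omega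

/-- `ord₂(2^e · L²) = e + 2·ord₂ L` for a non-zero integer `L` and `e ∈ ℤ` (the odd-`L` case is
`padicValRat_two_zpow_mul_sq`). [folklore] -/
theorem padicValRat_two_zpow_mul_sq_of_ne_zero {L : ℤ} (hL : L ≠ 0) (e : ℤ) :
    padicValRat 2 ((2 : ℚ) ^ e * (L : ℚ) ^ 2) = e + 2 * (padicValInt 2 L : ℤ) := by
  haveI : Fact (Nat.Prime 2) := ⟨Nat.prime_two⟩
  have hL0 : (L : ℚ) ≠ 0 := by exact_mod_cast hL
  have h2 : padicValRat 2 (2 : ℚ) = 1 := by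
    rw [show (2 : ℚ) = ((2 : ℕ) : ℚ) by norm_num, padicValRat.of_nat]
    simp
  rw [padicValRat.mul (zpow_ne_zero _ two_ne_zero) (pow_ne_zero _ hL0), padicValRat.zpow,
    padicValRat.pow, padicValRat.of_int, h2]
  push_cast
  ring

/-- **TIAN–YUAN–ZHANG'S (1.1) READ AT THE PRIME `2`, ALL LEVELS.** For square-free `n`, granted
Gross–Zagier–Kolyvagin (`hGZK`): if `ord_{s=1} L(E_n, s) = 1` and `𝓛(n)² = L²` with `L ∈ ℤ` (`IsScriptL n L`),
then `rank E_n(ℚ) = 1`, `Ш(E_n/ℚ)` is finite, `L ≠ 0`, and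
**`BSD(E_n, 2) ⟺ 2 · ord₂ L = ord₂ #Ш(E_n)[2^∞]`**. Proof: `L′(E_n, 1) = 2^{2k−2−a}·L²·Ω(E_n)·Reg(E_n)`
(the PROVED bridge: `Ω(E_n) = Ω_{n,∞}`, `R_n = Reg`), the rank-one spec
`BSD(E,2) ⟺ ord₂ x = ord₂ #Ш + ord₂ ∏c_ℓ − 2·ord₂ #E(ℚ)_tor` with `x = 2^{2k−2−a} L²`,
`ord₂ ∏c_ℓ = 2k + 2 − a`, `#E_n(ℚ)_tor = 4`, `ord₂ #Ш = ord₂ #Ш[2^∞]`. This is the authors' sentence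
"full BSD for `E_n` writes as `#Ш(E_n) = 𝓛(n)²`" restricted to the prime `2`, as a theorem (the tree's
`ScriptLBridgeProofs` proves the all-primes form). [cite: TianYuanZhang2017, §1 (1.1) (arXiv:1411.4728 p0002 L46–L75)]
[cite: Miller2011LMS, Def. 1.1 (arXiv:1010.2431 p. 3)] [cite: SilvermanAEC2009, Thm. X.4.2] -/
theorem bsdp_two_congruentNumberCurve_iff_of_isScriptL
    (hGZK : rank_eq_analyticRank_of_analyticRank_le_one) {n : ℕ} [(congruentNumberCurve n).IsElliptic]
    (hsq : Squarefree n) (hr : (congruentNumberCurve n).analyticRank = 1) {L : ℤ} (hL : IsScriptL n L) :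
    (congruentNumberCurve n).mordellWeilRank = 1 ∧ Finite (congruentNumberCurve n).sha ∧ L ≠ 0 ∧
      (BSDp (congruentNumberCurve n) 2 ↔
        2 * padicValInt 2 L =
          padicValNat 2 (Nat.card (AddCommGroup.primaryComponent (congruentNumberCurve n).sha 2))) := by
  haveI : Fact (Nat.Prime 2) := ⟨Nat.prime_two⟩
  have hlead := leadingLCoeff_congruentNumberCurve_eq_of_isScriptL (Nat.pos_of_ne_zero hsq.ne_zero) hr hL
  obtain ⟨hle, hder0⟩ := leadingLCoeff_eq_deriv_of_analyticRank_eq_one hr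
  have hx : deriv (congruentNumberCurve n).entireLFunction 1 =
      (((2 : ℚ) ^ twoExponent n * (L : ℚ) ^ 2 : ℚ) : ℂ) *
        ((congruentNumberCurve n).realPeriodRat : ℂ) * ((congruentNumberCurve n).regulator : ℂ) := by
    rw [← hle, hlead]; push_cast; ring
  have hL0 : L ≠ 0 := by
    rintro rfl
    apply hder0
    rw [hx]; simp
  obtain ⟨hfin, -, hiff⟩ := bsdp_two_iff_of_LDerivOverOmegaReg (congruentNumberCurve n) hGZK hr hx
  obtain ⟨hrank, -⟩ := hGZK (congruentNumberCurve n) (le_of_eq hr)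
  haveI := hfin
  refine ⟨hrank.trans hr, hfin, hL0, ?_⟩
  have h4 : padicValNat 2 (4 : ℕ) = 2 := by
    rw [show (4 : ℕ) = 2 ^ 2 by norm_num, padicValNat.prime_pow]
  have he := twoExponent_eq_padicValNat_tamagawaProduct_sub_four' hsq
  have hsha := padicValNat_card_addPrimaryComponent 2 (A := (congruentNumberCurve n).sha)
  rw [hiff, padicValRat_two_zpow_mul_sq_of_ne_zero hL0, he, torsionOrder_congruentNumberCurve hsq, h4,
    ← hsha]
  constructor <;> intro h <;> omega

/-! ## §2 The level-two door: `2 ∥ 𝓛(n)`, `#Sel₂ = 2⁵`, `#Sel₄ = 2⁶` ⟹ `BSD(E_n, 2)` — and its exactness -/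

/-- `2 ∣ L ∧ 4 ∤ L` pins `ord₂ L = 1` (`L ≠ 0` is automatic). [folklore] -/
theorem padicValInt_two_eq_one_of_two_dvd_of_not_four_dvd {L : ℤ} (h2 : (2 : ℤ) ∣ L) (h4 : ¬ (4 : ℤ) ∣ L) :
    L ≠ 0 ∧ padicValInt 2 L = 1 := by
  haveI : Fact (Nat.Prime 2) := ⟨Nat.prime_two⟩
  have hL0 : L ≠ 0 := fun h0 => h4 (by rw [h0]; exact dvd_zero _)
  refine ⟨hL0, le_antisymm ?_ ?_⟩
  · by_contra hlt
    refine h4 ?_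
    have h := (padicValInt_dvd_iff (p := 2) 2 L).mpr (Or.inr (by omega))
    simpa using h
  · have h := (padicValInt_dvd_iff (p := 2) 1 L).mp (by simpa using h2)
    rcases h with h | h
    · exact absurd h hL0
    · exact h

/-- Conversely `ord₂ L = 1` (with `L ≠ 0`) gives `2 ∣ L ∧ 4 ∤ L`. [folklore] -/
theorem two_dvd_and_not_four_dvd_of_padicValInt_two_eq_one {L : ℤ} (hL0 : L ≠ 0)
    (hv : padicValInt 2 L = 1) : (2 : ℤ) ∣ L ∧ ¬ (4 : ℤ) ∣ L := by
  haveI : Fact (Nat.Prime 2) := ⟨Nat.prime_two⟩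
  constructor
  · have h := (padicValInt_dvd_iff (p := 2) 1 L).mpr (Or.inr (by omega))
    simpa using h
  · intro h4
    have h := (padicValInt_dvd_iff (p := 2) 2 L).mp (by simpa using h4)
    rcases h with h | h
    · exact hL0 h
    · omega

/-- **THE LEVEL-TWO DOOR** (the transfer of the card `heegner-redei-level-two`, PROVED). For square-free `n`,
granted GZK: if `ord_{s=1} L(E_n, s) = 1`, `𝓛(n)² = L²` with `2 ∣ L`, `4 ∤ L` (the conclusion of the card's
research stub `C⁺ = LevelTwoScriptLExact`), `#Sel₂(E_n) = 2⁵` (`s(n) = 3`) and `#Sel₄(E_n) = 2⁶` (the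
Cassels–Tate jump-one condition), then `rank E_n(ℚ) = 1`, `Ш(E_n)[2^∞] = Ш(E_n)[2]` has exactly `4` elements
(`natCard_primaryComponent_sha_two_eq_four_of_selmerFour`, p599547), and **`BSD(E_n, 2)` holds**
(`2·ord₂ L = 2 = ord₂ 4`, §1). Hypotheses used: all; no residue-class condition on `n` is needed here
(it enters only through `C⁺`). [cite: TianYuanZhang2017, §1 (1.1)] [cite: Miller2011LMS, Def. 1.1]
[cite: SilvermanAEC2009, Thm. X.4.2] [cite: HeathBrown1994SelmerCongruentII, §1] -/
theorem bsdp_two_congruentNumberCurve_of_levelTwo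
    (hGZK : rank_eq_analyticRank_of_analyticRank_le_one) {n : ℕ} [(congruentNumberCurve n).IsElliptic]
    (hsq : Squarefree n) (hr : (congruentNumberCurve n).analyticRank = 1) {L : ℤ} (hL : IsScriptL n L)
    (h2 : (2 : ℤ) ∣ L) (h4 : ¬ (4 : ℤ) ∣ L)
    (hS₂ : Nat.card ((congruentNumberCurve n).selmerGroup 2) = 2 ^ 5)
    (hS₄ : Nat.card ((congruentNumberCurve n).selmerGroup 4) = 2 ^ 6) :
    (congruentNumberCurve n).mordellWeilRank = 1 ∧
      AddCommGroup.primaryComponent (congruentNumberCurve n).sha 2 =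
        AddSubgroup.torsionBy (congruentNumberCurve n).sha (2 : ℤ) ∧
      Nat.card (AddCommGroup.primaryComponent (congruentNumberCurve n).sha 2) = 4 ∧
      BSDp (congruentNumberCurve n) 2 := by
  haveI : Fact (Nat.Prime 2) := ⟨Nat.prime_two⟩
  obtain ⟨hrank, -, -, hiff⟩ := bsdp_two_congruentNumberCurve_iff_of_isScriptL hGZK hsq hr hL
  obtain ⟨heq, hcard⟩ := primaryComponent_sha_two_eq_of_natCard_selmerGroup hsq (u := 2)
    (by rw [hS₂, hrank]) (by rw [hS₄, hrank])
  have hv := (padicValInt_two_eq_one_of_two_dvd_of_not_four_dvd h2 h4).2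
  refine ⟨hrank, heq, by rw [hcard]; norm_num, hiff.mpr ?_⟩
  rw [hv, hcard, show (2 ^ 2 : ℕ) = 2 ^ 2 from rfl, padicValNat.prime_pow]

/-- **THE LEVEL-TWO DOOR IS EXACT on the jump-one class.** For square-free `n`, granted GZK, with
`ord_{s=1} L(E_n, s) = 1`, `𝓛(n)² = L²`, `#Sel₂(E_n) = 2⁵` and `#Sel₄(E_n) = 2⁶` (so `#Ш(E_n)[2^∞] = 4`):
**`BSD(E_n, 2) ⟺ (2 ∣ L ∧ 4 ∤ L)`** — on the Cassels–Tate jump-one part of category D with analytic rank one,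
the `2`-part of BSD for `E_n` IS the statement `2 ∥ 𝓛(n)` (the card's `C⁺` is equivalent to BSD₂ there, not
just sufficient). [cite: TianYuanZhang2017, §1 (1.1)] [cite: Miller2011LMS, Def. 1.1] [cite: SilvermanAEC2009, Thm. X.4.2] -/
theorem bsdp_two_congruentNumberCurve_iff_two_dvd_not_four_dvd
    (hGZK : rank_eq_analyticRank_of_analyticRank_le_one) {n : ℕ} [(congruentNumberCurve n).IsElliptic]
    (hsq : Squarefree n) (hr : (congruentNumberCurve n).analyticRank = 1) {L : ℤ} (hL : IsScriptL n L)
    (hS₂ : Nat.card ((congruentNumberCurve n).selmerGroup 2) = 2 ^ 5)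
    (hS₄ : Nat.card ((congruentNumberCurve n).selmerGroup 4) = 2 ^ 6) :
    BSDp (congruentNumberCurve n) 2 ↔ (2 : ℤ) ∣ L ∧ ¬ (4 : ℤ) ∣ L := by
  haveI : Fact (Nat.Prime 2) := ⟨Nat.prime_two⟩
  refine ⟨fun h => ?_, fun h => (bsdp_two_congruentNumberCurve_of_levelTwo hGZK hsq hr hL h.1 h.2 hS₂ hS₄).2.2.2⟩
  obtain ⟨hrank, -, hL0, hiff⟩ := bsdp_two_congruentNumberCurve_iff_of_isScriptL hGZK hsq hr hL
  have hcard := natCard_primaryComponent_sha_two_eq_four_of_selmerFour n hsq hrank hS₂ hS₄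
  have h2v := hiff.mp h
  rw [hcard, show (4 : ℕ) = 2 ^ 2 by norm_num, padicValNat.prime_pow] at h2v
  exact two_dvd_and_not_four_dvd_of_padicValInt_two_eq_one hL0 (by omega)

/-- **Model transport of the level-two door**: under the hypotheses of
`bsdp_two_congruentNumberCurve_of_levelTwo`, every globally minimal `W` with `C • E_n = W` has analytic rank
`1` and satisfies `BSD(W, 2)` (ty2 g1's fact-free `CornerFTwo.CongruentNumber.analyticRank_eq_one_and_bsdp_two_of_smul`).
[cite: Miller2011LMS, Def. 1.1] [cite: TianYuanZhang2017, §1 (1.1)] -/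
theorem analyticRank_eq_one_and_bsdp_two_of_levelTwo_of_smul
    (hGZK : rank_eq_analyticRank_of_analyticRank_le_one) {n : ℕ} [(congruentNumberCurve n).IsElliptic]
    (hsq : Squarefree n) (hr : (congruentNumberCurve n).analyticRank = 1) {L : ℤ} (hL : IsScriptL n L)
    (h2 : (2 : ℤ) ∣ L) (h4 : ¬ (4 : ℤ) ∣ L)
    (hS₂ : Nat.card ((congruentNumberCurve n).selmerGroup 2) = 2 ^ 5)
    (hS₄ : Nat.card ((congruentNumberCurve n).selmerGroup 4) = 2 ^ 6)
    {W : WeierstrassCurve ℚ} [W.IsElliptic] [W.IsGloballyMinimal] {C : VariableChange ℚ}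
    (hC : C • congruentNumberCurve n = W) :
    W.analyticRank = 1 ∧ BSDp W 2 :=
  CornerFTwo.CongruentNumber.analyticRank_eq_one_and_bsdp_two_of_smul hsq
    ⟨hr, (bsdp_two_congruentNumberCurve_of_levelTwo hGZK hsq hr hL h2 h4 hS₂ hS₄).2.2.2⟩ hC

/-! ## §3 The card's skeleton composed: `C⁺` (hypothesis) ∧ TYZ Thm 1.2′ ∧ GZK ⟹ BSD₂ on the jump-one class -/

/-- **Integrality of `𝓛(n)` from TYZ Thm 1.2 AS PRINTED**: for square-free `n ≡ 5, 6, 7 (mod 8)` there is an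
integer `L` with `𝓛(n)² = L²` (`ρ(n)` exists by `W2.stub_S3`; genus fields `GenusField`). [cite: TianYuanZhang2017, Thm. 1.2 (arXiv:1411.4728 p0002 L101–L127)] -/
theorem exists_isScriptL_of_thm12' (h12 : thm12_parity_of_scriptL') {n : ℕ}
    [(congruentNumberCurve n).IsElliptic] (hsq : Squarefree n) (h8 : n % 8 = 5 ∨ n % 8 = 6 ∨ n % 8 = 7) :
    ∃ L : ℤ, IsScriptL n L := by
  obtain ⟨ρ, hρ⟩ := W2.stub_S3 hsq
  obtain ⟨L, hL, -, -⟩ := h12 n hsq h8 ρ hρ GenusField (isGenusFieldFamily_genusField n)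
  exact ⟨L, hL⟩

/-- **THE CARD'S SKELETON, COMPOSED.** Let `C⁺` be the research statement `LevelTwoScriptLExact` of the card
`heegner-redei-level-two`, taken here as a HYPOTHESIS in its exact binder shape (nothing is declared): for
square-free `n ≡ 5, 6, 7 (mod 8)` with `ord_{s=1} L(E_n,s) = 1`, `#Sel₂(E_n) = 2⁵`, `#Sel₄(E_n) = 2⁶`, every
integer `L` with `𝓛(n)² = L²` satisfies `2 ∣ L ∧ 4 ∤ L`. THEN, granted TYZ Thm 1.2 as printed (`h12'`,
conjunct 5 of `𝔅_ram`: `𝓛(n)` is an integer) and GZK (`hGZK`, conjunct 1): every such `E_n` satisfies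
**`BSD(E_n, 2)`** (and rank `1`, `#Ш(E_n)[2^∞] = 4`). I.e. `stub_levelTwoScriptL ⟹ (𝔅_ram ⟹ BSD₂ on
{n ∈ D : r_an = 1, #Sel₄ = 2⁶})`: of the card's skeleton only `C⁺` and the complementary residual remain.
[cite: TianYuanZhang2017, Thm. 1.2 and §1 (1.1)] [cite: Miller2011LMS, Def. 1.1] [cite: SilvermanAEC2009, Thm. X.4.2] -/
theorem bsdp_two_congruentNumberCurve_of_levelTwoScriptLExact
    (h12 : thm12_parity_of_scriptL') (hGZK : rank_eq_analyticRank_of_analyticRank_le_one)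
    (hC : ∀ (n : ℕ) [(congruentNumberCurve n).IsElliptic] [(congruentNumberCurve n).IsGloballyMinimal],
      Squarefree n → (n % 8 = 5 ∨ n % 8 = 6 ∨ n % 8 = 7) →
      (congruentNumberCurve n).analyticRank = 1 →
      Nat.card ((congruentNumberCurve n).selmerGroup 2) = 2 ^ 5 →
      Nat.card ((congruentNumberCurve n).selmerGroup 4) = 2 ^ 6 →
      ∀ L : ℤ, IsScriptL n L → (2 : ℤ) ∣ L ∧ ¬ (4 : ℤ) ∣ L)
    {n : ℕ} [(congruentNumberCurve n).IsElliptic] [(congruentNumberCurve n).IsGloballyMinimal]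
    (hsq : Squarefree n) (h8 : n % 8 = 5 ∨ n % 8 = 6 ∨ n % 8 = 7)
    (hr : (congruentNumberCurve n).analyticRank = 1)
    (hS₂ : Nat.card ((congruentNumberCurve n).selmerGroup 2) = 2 ^ 5)
    (hS₄ : Nat.card ((congruentNumberCurve n).selmerGroup 4) = 2 ^ 6) :
    (congruentNumberCurve n).mordellWeilRank = 1 ∧
      Nat.card (AddCommGroup.primaryComponent (congruentNumberCurve n).sha 2) = 4 ∧
      BSDp (congruentNumberCurve n) 2 := by
  obtain ⟨L, hL⟩ := exists_isScriptL_of_thm12' h12 hsq h8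
  obtain ⟨h2, h4⟩ := hC n hsq h8 hr hS₂ hS₄ L hL
  have h := bsdp_two_congruentNumberCurve_of_levelTwo hGZK hsq hr hL h2 h4 hS₂ hS₄
  exact ⟨h.1, h.2.2.1, h.2.2.2⟩

/-- **The same on every globally minimal `ℚ`-model** `W` of a member of the jump-one class (the shape in which
a W-ALL leaf consumes it: `∃ C, C • E_n = W`). [cite: Miller2011LMS, Def. 1.1] [cite: TianYuanZhang2017, Thm. 1.2 and §1 (1.1)] -/
theorem analyticRank_eq_one_and_bsdp_two_of_levelTwoScriptLExact_of_smul
    (h12 : thm12_parity_of_scriptL') (hGZK : rank_eq_analyticRank_of_analyticRank_le_one)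
    (hC : ∀ (n : ℕ) [(congruentNumberCurve n).IsElliptic] [(congruentNumberCurve n).IsGloballyMinimal],
      Squarefree n → (n % 8 = 5 ∨ n % 8 = 6 ∨ n % 8 = 7) →
      (congruentNumberCurve n).analyticRank = 1 →
      Nat.card ((congruentNumberCurve n).selmerGroup 2) = 2 ^ 5 →
      Nat.card ((congruentNumberCurve n).selmerGroup 4) = 2 ^ 6 →
      ∀ L : ℤ, IsScriptL n L → (2 : ℤ) ∣ L ∧ ¬ (4 : ℤ) ∣ L)
    {n : ℕ} [(congruentNumberCurve n).IsElliptic] [(congruentNumberCurve n).IsGloballyMinimal]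
    (hsq : Squarefree n) (h8 : n % 8 = 5 ∨ n % 8 = 6 ∨ n % 8 = 7)
    (hr : (congruentNumberCurve n).analyticRank = 1)
    (hS₂ : Nat.card ((congruentNumberCurve n).selmerGroup 2) = 2 ^ 5)
    (hS₄ : Nat.card ((congruentNumberCurve n).selmerGroup 4) = 2 ^ 6)
    {W : WeierstrassCurve ℚ} [W.IsElliptic] [W.IsGloballyMinimal] {C : VariableChange ℚ}
    (hCW : C • congruentNumberCurve n = W) :
    W.analyticRank = 1 ∧ BSDp W 2 :=
  CornerFTwo.CongruentNumber.analyticRank_eq_one_and_bsdp_two_of_smul hsq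
    ⟨hr, (bsdp_two_congruentNumberCurve_of_levelTwoScriptLExact h12 hGZK hC hsq h8 hr hS₂ hS₄).2.2⟩ hCW

/-! ## §4 Leaf currency: the analytic rank read on the model `W` (append, ty2 g11) -/

/-- **The level-two door in W-ALL leaf currency.** A W-ALL leaf quantifies over a globally minimal `W/ℚ` with
`W.analyticRank = 1` and a membership witness `∃ C, C • E_n = W`; the analytic rank is an invariant of the
`ℚ`-isomorphism class (ty2 g1's fact-free `CornerFTwo.CongruentNumber.analyticRank_eq`), so the door of §2
applies with `r_an` read on `W`: granted GZK, `IsScriptL n L` with `2 ∣ L`, `4 ∤ L`, `#Sel₂(E_n) = 2⁵`,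
`#Sel₄(E_n) = 2⁶` ⟹ `BSD(W, 2)`. [cite: Miller2011LMS, Def. 1.1] [cite: TianYuanZhang2017, §1 (1.1)] -/
theorem bsdp_two_of_levelTwo_of_smul_of_analyticRank_eq_one
    (hGZK : rank_eq_analyticRank_of_analyticRank_le_one) {n : ℕ} [(congruentNumberCurve n).IsElliptic]
    (hsq : Squarefree n) {L : ℤ} (hL : IsScriptL n L) (h2 : (2 : ℤ) ∣ L) (h4 : ¬ (4 : ℤ) ∣ L)
    (hS₂ : Nat.card ((congruentNumberCurve n).selmerGroup 2) = 2 ^ 5)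
    (hS₄ : Nat.card ((congruentNumberCurve n).selmerGroup 4) = 2 ^ 6)
    {W : WeierstrassCurve ℚ} [W.IsElliptic] [W.IsGloballyMinimal] (hrW : W.analyticRank = 1)
    (hW : ∃ C : VariableChange ℚ, C • congruentNumberCurve n = W) :
    BSDp W 2 := by
  obtain ⟨C, hC⟩ := hW
  have hr : (congruentNumberCurve n).analyticRank = 1 :=
    (CornerFTwo.CongruentNumber.analyticRank_eq hsq.ne_zero ⟨C, hC⟩).symm.trans hrW
  exact (analyticRank_eq_one_and_bsdp_two_of_levelTwo_of_smul hGZK hsq hr hL h2 h4 hS₂ hS₄ hC).2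

/-- **The card's skeleton in W-ALL leaf currency**: `C⁺` (hypothesis, verbatim), TYZ Thm 1.2′ and GZK give
`BSD(W, 2)` for every globally minimal `W` of analytic rank one that is a `ℚ`-model of some `E_n` with
`n ≡ 5, 6, 7 (mod 8)` square-free, `#Sel₂(E_n) = 2⁵`, `#Sel₄(E_n) = 2⁶` — the exact shape in which a leaf
«ramified slice ON the level-two jump-one class» would be closed BY NAME once `C⁺` is a theorem.
[cite: Miller2011LMS, Def. 1.1] [cite: TianYuanZhang2017, Thm. 1.2 and §1 (1.1)] -/
theorem bsdp_two_of_levelTwoScriptLExact_of_smul_of_analyticRank_eq_one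
    (h12 : thm12_parity_of_scriptL') (hGZK : rank_eq_analyticRank_of_analyticRank_le_one)
    (hC : ∀ (n : ℕ) [(congruentNumberCurve n).IsElliptic] [(congruentNumberCurve n).IsGloballyMinimal],
      Squarefree n → (n % 8 = 5 ∨ n % 8 = 6 ∨ n % 8 = 7) →
      (congruentNumberCurve n).analyticRank = 1 →
      Nat.card ((congruentNumberCurve n).selmerGroup 2) = 2 ^ 5 →
      Nat.card ((congruentNumberCurve n).selmerGroup 4) = 2 ^ 6 →
      ∀ L : ℤ, IsScriptL n L → (2 : ℤ) ∣ L ∧ ¬ (4 : ℤ) ∣ L)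
    {W : WeierstrassCurve ℚ} [W.IsElliptic] [W.IsGloballyMinimal] (hrW : W.analyticRank = 1)
    (hW : ∃ (n : ℕ) (C : VariableChange ℚ), Squarefree n ∧ (n % 8 = 5 ∨ n % 8 = 6 ∨ n % 8 = 7) ∧
      Nat.card ((congruentNumberCurve n).selmerGroup 2) = 2 ^ 5 ∧
      Nat.card ((congruentNumberCurve n).selmerGroup 4) = 2 ^ 6 ∧ C • congruentNumberCurve n = W) :
    BSDp W 2 := by
  obtain ⟨n, C, hsq, h8, hS₂, hS₄, hC'⟩ := hW
  haveI := isElliptic_congruentNumberCurve hsq.ne_zero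
  haveI := isGloballyMinimal_congruentNumberCurve hsq
  have hr : (congruentNumberCurve n).analyticRank = 1 :=
    (CornerFTwo.CongruentNumber.analyticRank_eq hsq.ne_zero ⟨C, hC'⟩).symm.trans hrW
  exact (analyticRank_eq_one_and_bsdp_two_of_levelTwoScriptLExact_of_smul h12 hGZK hC hsq h8 hr hS₂ hS₄
    hC').2

end Summit.BirchSwinnertonDyer.Rank1Residual.P2

end
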